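import Summits.ResolutionOfSingularities.ResolutionOfSingularities.Theorems.MarkedTransferCampaignW23FlagChainPackage
import Summits.ResolutionOfSingularities.ResolutionOfSingularities.Theorems.MarkedTransferCampaignW23Thm918FlagChainsProof
import HarnessLib

/-!
# [OURS · L1 W2.3] The §9.9 package for the flag chains — PROOFS of the statements of
# `Theorems/MarkedTransferCampaignW23FlagChainPackage.lean`
# (RESCUE-SEED slot W2.3 «tails without `H♭`», group L-G2; cell `res-hironaka`, rung L of LADDER-RESOLUTION)

HONEST FRAMING. Everything here is OURS (campaign statements of the cell `res-hironaka` and their kernel proofs);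
NOTHING is a statement of H. Hironaka's manuscript [Hironaka2017] and nothing is attributed to its author; the typed
carriers of rung S enter only as parameters / hypotheses. AI review is weaker than expert review.

PROVED HERE (0 `sorry`, axioms ⊆ {propext, Classical.choice, Quot.sound}):
* `headCotangentClassWellDefined_holds p : HeadCotangentClassWellDefined p` — `KnockOutOrderDescent` (p478724,
  proved in `…Thm918FlagChainsProof.lean`) applied to the constant-power sequence `j ↦ y'^{p^{e−j}}` from
  `y^{p^e} + (ε − ε')`, all of whose knock-outs vanish.
* `isFlagChainSeq_revHeadDescent` (the reversed head descent `g, y^{p^{e−1}}, …, y` — p464759's `headDescent` read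
  downwards — is a flag chain sequence once `ϵ(0)` lies in the top bracketed negative sum) and
  `flagChainsExist_holds p : FlagChainsExist p`. No definitions in this file.
* `cor919ForFlagChains_holds p : Cor919ForFlagChains p` — the generating set of tail classes EQUALS the generating set
  of head-parameter classes (`IsFlagChainSeq.tail_sub_y_mem_sq`, `Ideal.toCotangent_eq`), so the two spans of the typed
  `S09LLUED.Cor9_19` coincide.

## References
* Tree (OURS): `Theorems/MarkedTransferCampaignW23FlagChainPackage.lean` (statements), `…Thm918FlagChains.lean`
  (p478724) and `…Thm918FlagChainsProof.lean`; `Literature/…/S09LLUED/R062Thm918.lean` (`Cor9_19`),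
  `Literature/…/Proofs/S09/Thm918.lean` (p469679). Cell files: plan/RESCUE-SEED.md §1 L-G2 W2.3; L/SLOTS.md §2 W2.3
  (INDEX ONLY).
* H. Hironaka, ms. 2017-03-23: Eq. (82)–(84) p.54–55, Th. 9.18 / Cor. 9.19 p.55 L34 – p.56 L5 — scope only, under
  adjudication, not cited as fact. [Hironaka2017]
-/

set_option linter.dupNamespace false -- mandated namespace of this single-conjunct summit

namespace Summit.ResolutionOfSingularities.ResolutionOfSingularities.Theorems

namespace CampaignW23

open Literature.AlgebraicGeometry.Hironaka2017.S16Proof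
open Literature.AlgebraicGeometry.Hironaka2017.S09LLUED
open Literature.AlgebraicGeometry.Resolution
open IsLocalRing

universe u

/-- [OURS · L1 W2.3] `HeadCotangentClassWellDefined p` HOLDS for every prime `p`: `KnockOutOrderDescent` (p478724) applied
to the constant-power sequence `j ↦ y'^{p^{e−j}}`, whose knock-outs all vanish. [folklore] -/
theorem headCotangentClassWellDefined_holds (p : ℕ) [Fact p.Prime] : HeadCotangentClassWellDefined p := by
  intro O _ _ _ e y y' ε ε' hε hε' hg
  -- the sequence `c j = y'^{p^{e-j}}` starts at `y^{p^e} + (ε - ε')` and has zero knock-outs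
  have hc0 : (fun j => y' ^ p ^ (e - j)) 0 = y ^ p ^ e + (ε - ε') := by
    show y' ^ p ^ (e - 0) = _
    rw [Nat.sub_zero]
    linear_combination -hg
  have hεε : ((p ^ e : ℕ) : ℕ∞) < adicOrder (ε - ε') := by
    rw [lt_adicOrder_iff_mem_pow_succ] at hε hε' ⊢
    exact Ideal.sub_mem _ hε hε'
  have hko : ∀ j : ℕ, j < e →
      ((p ^ (e - j) : ℕ) : ℕ∞) < adicOrder ((fun j => y' ^ p ^ (e - j)) j - (fun j => y' ^ p ^ (e - j)) (j + 1) ^ p) := by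
    intro j hj
    have : (fun j => y' ^ p ^ (e - j)) j - (fun j => y' ^ p ^ (e - j)) (j + 1) ^ p = 0 := by
      show y' ^ p ^ (e - j) - (y' ^ p ^ (e - (j + 1))) ^ p = 0
      rw [← pow_mul, ← pow_succ, show e - (j + 1) + 1 = e - j by omega, sub_self]
    rw [this, adicOrder_zero]
    exact ENat.coe_lt_top _
  have h := knockOutOrderDescent_holds p O e y (ε - ε') (fun j => y' ^ p ^ (e - j)) hεε hc0 hko e le_rfl
  simp only [Nat.sub_self, pow_zero, pow_one] at h
  have h' : y' - y ∈ maximalIdeal O ^ 2 := by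
    have := (lt_adicOrder_iff_mem_pow_succ (y' - y) 1).mp (by exact_mod_cast h)
    simpa using this
  have : y - y' = -(y' - y) := by ring
  rw [this]
  exact Submodule.neg_mem _ h'

section Exist

variable {p : ℕ} [Fact p.Prime] {O : Type u} [CommRing O] [IsLocalRing O] [CharP O p] {ℓ : ℕ}
  {frakL : ℕ → Set O} {cot : Set O} {IsGCleaned : O → ℕ → O → Prop}

/-- [OURS · L1 W2.3] THE REVERSED HEAD DESCENT `g, y^{p^{e−1}}, …, y` (p464759's `headDescent` read downwards) IS a flag
chain sequence as soon as `ϵ(0)` lies in the top bracketed negative sum (top knock-out `ϵ(0)`, all later ones `0`).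
[folklore] -/
theorem isFlagChainSeq_revHeadDescent (I : InductionInput p O ℓ) (D : LLChainHead O p frakL cot IsGCleaned)
    (he : D.e = I.e) (hε : D.ε0 ∈ forgetDegrees p O ℓ (I.negaSum I.e)) :
    IsFlagChainSeq I D (fun j => if j = 0 then D.g else D.y ^ p ^ (I.e - j)) := by
  refine ⟨he, if_pos rfl, fun j hj => ?_⟩
  show (if j = 0 then D.g else D.y ^ p ^ (I.e - j)) -
      (if j + 1 = 0 then D.g else D.y ^ p ^ (I.e - (j + 1))) ^ p ∈ forgetDegrees p O ℓ (I.negaSum (I.e - j))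
  rw [if_neg (Nat.succ_ne_zero j), ← pow_mul, ← pow_succ]
  rcases Nat.eq_zero_or_pos j with rfl | hjpos
  · have hg : D.g = D.y ^ p ^ I.e + D.ε0 := by rw [← he]; rfl
    rw [if_pos rfl, show I.e - (0 + 1) + 1 = I.e by omega, hg, add_sub_cancel_left, Nat.sub_zero]
    exact hε
  · rw [if_neg (Nat.pos_iff_ne_zero.mp hjpos), show I.e - (j + 1) + 1 = I.e - j by omega, sub_self]
    exact Submodule.zero_mem _

end Exist

/-- [OURS · L1 W2.3] `FlagChainsExist p` HOLDS for every prime `p` (witness: the reversed head descent). [folklore] -/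
theorem flagChainsExist_holds (p : ℕ) [Fact p.Prime] : FlagChainsExist p :=
  fun _ _ _ _ _ I _ _ _ D he hε => ⟨_, isFlagChainSeq_revHeadDescent I D he hε⟩

/-- [OURS · L1 W2.3] `Cor919ForFlagChains p` HOLDS for every prime `p`: the generating set of tail classes EQUALS the
generating set of head-parameter classes (each tail class is its head's class, `IsFlagChainSeq.tail_sub_y_mem_sq`).
[folklore] -/
theorem cor919ForFlagChains_holds (p : ℕ) [Fact p.Prime] : Cor919ForFlagChains p := by
  intro O _ _ _ ℓ I hI frakL cot IsGCleaned
  unfold Cor9_19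
  congr 1
  ext w
  simp only [Set.mem_setOf_eq]
  constructor
  · rintro ⟨D, c, h, hc, rfl⟩
    have hy := (mem_and_not_mem_sq_of_adicOrder_eq_one D.ord_y).1
    refine ⟨D, c, hy, hc, ?_⟩
    rw [Ideal.toCotangent_eq]
    exact hc.tail_sub_y_mem_sq hI
  · rintro ⟨D, c, hy, hc, rfl⟩
    have hsub := hc.tail_sub_y_mem_sq hI
    have ht : c D.e ∈ maximalIdeal O := by
      have : c D.e = (c D.e - D.y) + D.y := by ring
      rw [this]
      exact Ideal.add_mem _ (Ideal.pow_le_self two_ne_zero hsub) hy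
    refine ⟨D, c, ht, hc, ?_⟩
    rw [Ideal.toCotangent_eq]
    have : D.y - c D.e = -(c D.e - D.y) := by ring
    rw [this]
    exact Submodule.neg_mem _ hsub

end CampaignW23

end Summit.ResolutionOfSingularities.ResolutionOfSingularities.Theorems
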